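import Mathlib
import Literature.Algebra.Polynomial.PolyaPositivstellensatz
import Literature.Algebra.Polynomial.DsosSdsos
import HarnessLib

/-!
# An optimization-free certificate of positive definiteness (Ahmadi–Hall 2019, §4.1): a form `p` is
# positive definite iff, for some `r`, `(p(v²−w²) − (1/r)(Σ(v_i²−w_i²)²)^d + (1/2r)(Σ v_i⁴+w_i⁴)^d)·(Σv_i²+Σw_i²)^{r²}`
# has nonnegative coefficients — soundness, completeness via Pólya–Powers–Reznick, and the
# `r`-dsos form of the statement (Ahmadi–Majumdar 2019, Theorem 8)

Topic `Literature/Algebra/Polynomial`, namespace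
`Literature.Algebra.Polynomial.OptimizationFreePositivstellensatz`; real forms `p : MvPolynomial σ ℝ`,
`IsHomogeneous p (2d)`, in `n = |σ| ≥ 1` variables; the lifted forms live in `MvPolynomial (σ ⊕ σ) ℝ`
(`v_i = X (inl i)`, `w_i = X (inr i)`).  Builds BY NAME on
`Literature.Algebra.Polynomial.polya_powersReznick` (Pólya's theorem with the Powers–Reznick bound,
[PowersReznick2001, Thm 1], file `PolyaPositivstellensatz.lean`) and on `DsosSdsos.lean`
(`IsDsos`, `IsRDsos r p := IsDsos (p·(Σ x_i²)^r)`, `IsRDsos.eval_nonneg`,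
`isDsos_expand_two_of_coeff_nonneg`, [AhmadiMajumdar2019, §3]).  HONEST FRAMING: the engines group's
code (`certsdp.lp`, dd-Gram LPs) is shared numerical machinery serving client cells and rigour lives in
the verifiers; this file certifies published mathematics such code relies on ("multiply two polynomials
and check the signs of the coefficients" as a complete test of positive definiteness, and its LP / r-dsos
variant), not any run of the code.

Sources, read page by page (`lit read arxiv:1709.09307`, the held text of [AhmadiHall2019], whose
environments are numbered consecutively per kind — Theorem 11 = the paper's Theorem (th:sms.hierarchy)
of §4.1, Theorem 12 = Powers–Reznick, Lemma 1 = (th:Reznick.even), Lemma 2 = (lem:outstrip),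
Corollary 2 = "An optimization-free Positivstellensatz", Corollary 3 = the LP/SOCP hierarchies of §4.2;
this numbering is used in the `[cite: …]` tags), and `lit read arxiv:1706.02586` p. 12 for
[AhmadiMajumdar2019, Theorem 8]:

* [AhmadiHall2019] A. A. Ahmadi, G. Hall, *On the construction of converging hierarchies for polynomial
  optimization based on certificates of global positivity*, Math. Oper. Res. 44 (2019) 1192–1207
  (arXiv:1709.09307), §4.1 "An optimization-free hierarchy of lower bounds for POPs".
  - The lifting (before Theorem 12): "any scalar `x` can be written as `x = v² − w²` with `vw = 0`
    (take `v = √max{x,0}` and `w = √max{−x,0}`).  We then replace the form `p(z)` … by the even form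
    `p(v²−w²)` in variables `(v,w) ∈ ℝ^{2n}`.  This lifting operation preserves nonnegativity, but
    unfortunately it does not preserve positivity … This is what leads us to consider the slightly more
    complicated form `p(v²−w²) + (1/2r)(Σ_i v_i⁴+w_i⁴)^d`" (`liftSq`, `quart`, `pForm`).
  - Theorem 11, the set `Pol^r_{n,2d} := {p ∈ H_{n,2d} | (p(v²−w²) + (1/2r)(Σ_{i=1}^n (v_i⁴+w_i⁴))^d)·
    (Σ_i v_i² + Σ_i w_i²)^{r²}` has nonnegative coefficients}` (`MemPol r d p`) and the level-`r` test
    `f_γ(z) − (1/r)(Σ_{i=1}^N z_i²)^D ∈ Pol^r_{N,2D}`; (eq:def.p.gamma)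
    `p_{γ,r}(v,w) := f_γ(v²−w²) − (1/r)(Σ_i (v_i²−w_i²)²)^D + (1/2r)(Σ_i (v_i⁴+w_i⁴))^D`
    (`pForm D (1/r) (1/(2r)) f`, see `liftSq_level`).  The two halves of the proof of Theorem 11 are
    formalised for an ARBITRARY form `p` of degree `2d` in place of the special form `f_γ` of the
    paper's (eq:f.gamma) (the polynomial-optimization wrapper — Theorem 7 (th:slb), the sequences
    `l_r`, `m_r` and `lim m_r = p^*` — is not formalised here):
    · "m_r ≤ p^*" half (Proof 8): "if `f_γ(z) − (1/r)(Σ_i z_i²)^D ∈ Pol^r_{N,2D}` for some `r`, then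
      `f_γ` must be positive definite": the product has nonnegative coefficients and is even, hence (it
      is a nonnegative combination of squared monomials — the mechanism of Corollary 3, made explicit as
      `isRDsos_of_memPol`) the form `p_{γ,r}` is nonnegative; then (eq:ineq.tv.screen)–(eq:ineq.sphere):
      "let `ẑ⁺ = max(ẑ,0)` and `ẑ⁻ = max(−ẑ,0)` … take `v̂ = √ẑ⁺` and `ŵ = √ẑ⁻` … `ẑ = v̂² − ŵ²`,
      `Σ_i v̂_i⁴ + Σ_i ŵ_i⁴ = 1` … we conclude that `f_γ(z) ≥ 1/(2r) ∀ z ∈ S_z` and that `f_γ` is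
      positive definite" — here in the homogeneous (un-normalised) form `p(z) ≥ (1/2r)(Σ z_i²)^d` for
      all `z` (`le_eval_of_pForm_nonneg`, `le_eval_of_memPol`, `posDef_of_memPol`).
    · "lim m_r = p^*" half (first paragraph of p. 12 of the held text) with Lemma 2 (lem:outstrip):
      "As `f_γ` is pd there exists a positive integer `r₀` such that `f_γ(z) − (1/r)(Σ z_i²)^D` is pd
      for all `r ≥ r₀`" (`exists_pos_mul_le_eval`: `p(z) ≥ μ (Σ z_i²)^d`, `μ > 0`, so `r₀ = ⌈1/μ⌉`);
      "`||x||₂ ≤ n^{1/4} ||x||₄` … `p_{γ,r}(v,w) ≥ (1/(2^{D+1} N^D r))(Σ v_i² + Σ w_i²)^{2D} ∀ r ≥ r₀`"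
      (eq:min.p.gamma) — here as the bound `q_r ≥ (1/2r)(1/2n)^d` on the standard simplex for the
      form `q_r(v,w) := p_{γ,r}(√v,√w)` to which Powers–Reznick is applied; "`||q_{γ,r}|| ≤ ||f̄_γ|| +
      ||(Σ(v_i−w_i)²)^D|| + ||(Σ v_i²+w_i²)^D|| =: c_γ`" for every `r ≥ 1` (a coefficient bound uniform
      in `r`); "taking `r̂ = max(r₀, ⌈D(2D−1)2^{D+1}N^D c_γ⌉)` we have `r² ≥ N̄(r) ∀ r ≥ r̂`", i.e. the
      Powers–Reznick exponent needed for `q_r` is eventually below `r²`; then (Lemma 1 (th:Reznick.even),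
      Powers–Reznick transported to even forms through `q(x) = p(√x)`: `coeff_mul_sumSq_pow_nonneg_of_even`)
      `p_{γ,r}(v,w)·(Σ v_i²+Σ w_i²)^{r²}` has nonnegative coefficients (`exists_memPol_of_posDef`: for all
      `r ≥ r₁`; the threshold produced is `max(⌈1/μ⌉, ⌈2(2n)^d·C(2d,2)·c⌉ + 1)` with `c` the sum of the
      `ℓ¹` coefficient norms of `p(v−w)`, `(Σ(v_i−w_i)²)^d`, `(Σ v_i²+w_i²)^d`, which plays the role of
      `c_γ` under the in-tree normalisation of the Powers–Reznick bound).
  - Together (the global-positivity case of Corollary 2, "An optimization-free Positivstellensatz"; there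
    stated for a compact basic semialgebraic set through the form `h` of Theorem 7, not formalised):
    a form `p` of degree `2d` in `n ≥ 1` variables is positive definite iff for some positive integer `r`
    the polynomial `(p(v²−w²) − (1/r)(Σ(v_i²−w_i²)²)^d + (1/2r)(Σ v_i⁴+w_i⁴)^d)·(Σ v_i²+Σ w_i²)^{r²}` has
    nonnegative coefficients (`posDef_iff_exists_memPol`).
  - §4.2, proof of Corollary 3: "any even form … with nonnegative coefficients can be written as
    `z(x)ᵀQz(x)` where `Q` is diagonal and has nonnegative (diagonal) entries … such a `Q` is dd (and
    also sdd), we conclude that `p` is dsos" — `DsosSdsos.isDsos_expand_two_of_coeff_nonneg`; the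
    consequence used by the LP hierarchy, membership in `Pol^r` ⇒ `p_{γ,r}` is `r²`-dsos, is
    `isRDsos_of_memPol`.  (The optimization problems `l_r` of Corollary 3 themselves are not formalised.)
* [AhmadiMajumdar2019] A. A. Ahmadi, A. Majumdar, *DSOS and SDSOS optimization …*, SIAM J. Appl.
  Algebra Geom. 3 (2019), Theorem 8 ("see Section 4 of [AhmadiHall2019]"): "An `n`-variate form `p` of
  degree `2d` is positive definite if and only if there exists a positive integer `r` that makes the
  following form r-dsos: `p(v²−w²) − (1/√r)(Σ_{i=1}^n (v_i²−w_i²)²)^d + (1/(2√r))(Σ_{i=1}^n (v_i⁴+w_i⁴))^d`."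
  (`posDef_iff_exists_isRDsos`; "⇒" produces a perfect square `r`, as the reparametrisation `r ↦ r²` of
  [AhmadiHall2019] does.)
* [PowersReznick2001] V. Powers, B. Reznick, *A new bound for Pólya's theorem …*, J. Pure Appl. Algebra
  164 (2001), Theorem 1 — used only through the in-tree `polya_powersReznick` (hypotheses
  `|a_α| ≤ L·|α|!/α!`, `f ≥ λ` on `Δ`, `L·C(deg,2) < λ(N + deg)`), which is how [AhmadiHall2019, Thm 12]
  enters.

Conventions and scope.  `n ≥ 1` (`[Nonempty σ]`) wherever the source's argument divides by a norm of
`z` (with no variables both directions of Theorem 11 fail for constant `p`).  `r : ℕ`, and `1/r`, `1/2r`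
are real numbers (`r = 0` is never used: the existence statements produce `r ≥ 1` and the soundness
statements assume `0 < r`).  Positive definite = "`p(z) > 0` for all `z ≠ 0`".  Not here: §2–§3 of
[AhmadiHall2019] (Theorem 7 / (th:slb), the Artin and Reznick cones, Theorems 8–10), the POP sequences
`l_r`, `m_r` of Theorem 11 and Corollary 3 and their limits, Corollary 2 for semialgebraic sets, the
paper's exact constant `D(2D−1)2^{D+1}N^D c_γ` (our threshold is the analogous expression for the
in-tree form of the Powers–Reznick bound, recorded in the docstring of `exists_memPol_of_posDef`).
Nearest in-tree statements (searched before filing: `lean search --decl` for `AhmadiHall|RDsos|liftSq|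
posDef_iff|Positivstellensatz`): `DsosSdsos.exists_isRDsos_of_even_posDef` ([AhmadiMajumdar2019, Thm 7]:
EVEN pd forms are r-dsos for some `r`, via the ineffective `polya`) — this file removes evenness by the
`v² − w²` lifting and needs the effective bound; `PolyaPositivstellensatz.lean` (Pólya, Powers–Reznick,
Handelman); `PutinarPositivstellensatz.lean`, `LasserreHierarchy.lean` (SOS-side hierarchies).  No in-tree
declaration states the lifting, `Pol^r`, or Theorem 11 / Theorem 8.
-/

noncomputable section

open MvPolynomial Finset

open scoped BigOperators

namespace Literature.Algebra.Polynomial.OptimizationFreePositivstellensatz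

open Literature.Algebra.Polynomial.DsosSdsos (IsDsos IsRDsos isDsos_expand_two_of_coeff_nonneg)
open Sum

variable {σ : Type*} [Fintype σ]

/-! ### The lifted forms `p(v² − w²)`, `p_{γ,r}` and the set `Pol^r_{n,2d}` -/

omit [Fintype σ] in
/-- The lifting `p(z) ↦ p(v² − w²)` to `2n` variables `(v, w) = (X ∘ inl, X ∘ inr)`: "we replace the form
`p(z)` in variables `z ∈ ℝⁿ` by the even form `p(v²−w²)` in variables `(v,w) ∈ ℝ^{2n}`".
[cite: AhmadiHall2019, §4.1 before Theorem 12 (the lifting x = v² − w²)] -/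
def liftSq (p : MvPolynomial σ ℝ) : MvPolynomial (σ ⊕ σ) ℝ :=
  bind₁ (fun i => X (inl i) ^ 2 - X (inr i) ^ 2) p

variable (σ) in
/-- `Σ_i (v_i² − w_i²)²`, the lift of `Σ_i z_i²`. [cite: AhmadiHall2019, §4.1 Lemma 2 (eq:def.p.gamma)] -/
def diffSq : MvPolynomial (σ ⊕ σ) ℝ := ∑ i : σ, (X (inl i) ^ 2 - X (inr i) ^ 2) ^ 2

variable (σ) in
/-- `Σ_i (v_i⁴ + w_i⁴)`. [cite: AhmadiHall2019, §4.1 Theorem 11 (eq:def.Knd)] -/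
def quart : MvPolynomial (σ ⊕ σ) ℝ := ∑ i : σ, (X (inl i) ^ 4 + X (inr i) ^ 4)

/-- The form `p_{γ,r}` of (eq:def.p.gamma) with `f_γ ↦ p` and general real weights `a, b` in place of
`1/r, 1/(2r)`: `p(v²−w²) − a·(Σ_i (v_i²−w_i²)²)^d + b·(Σ_i (v_i⁴+w_i⁴))^d`
([AhmadiHall2019]: `a = 1/r`, `b = 1/(2r)`; [AhmadiMajumdar2019, Thm 8]: `a = 1/√r`, `b = 1/(2√r)`).
[cite: AhmadiHall2019, §4.1 Lemma 2 (eq:def.p.gamma) (the form p_{γ,r})] -/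
def pForm (d : ℕ) (a b : ℝ) (p : MvPolynomial σ ℝ) : MvPolynomial (σ ⊕ σ) ℝ :=
  liftSq p - C a * diffSq σ ^ d + C b * quart σ ^ d

/-- Membership `f ∈ Pol^r_{n,2d}`: "`(f(v²−w²) + (1/2r)(Σ_{i=1}^n (v_i⁴+w_i⁴))^d)·(Σ_i v_i² + Σ_i w_i²)^{r²}`
has nonnegative coefficients".  The level-`r` test of Theorem 11 is `MemPol r d (p − (1/r)(Σ_i z_i²)^d)`.
[cite: AhmadiHall2019, §4.1 Theorem 11 (eq:def.Knd) (the set Pol^r_{n,2d})] -/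
def MemPol (r d : ℕ) (f : MvPolynomial σ ℝ) : Prop :=
  ∀ m, 0 ≤ coeff m ((liftSq f + C (1 / (2 * (r : ℝ))) * quart σ ^ d) * (∑ j : σ ⊕ σ, X j ^ 2) ^ (r ^ 2))

/-! ### Plumbing: the forms before the substitution `(v, w) ↦ (v², w²)` -/

omit [Fintype σ] in
/-- `p(v − w)` (the paper's `f̄_γ(v,w) := f_γ(v − w)`; `p(v² − w²) = p(v − w)` after `X ↦ X²`). [folklore] -/
@[folklore] private def liftLin (p : MvPolynomial σ ℝ) : MvPolynomial (σ ⊕ σ) ℝ :=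
  bind₁ (fun i => X (inl i) - X (inr i)) p

variable (σ) in
/-- `Σ_i (v_i − w_i)²`. [folklore] -/
@[folklore] private def diffLinSq : MvPolynomial (σ ⊕ σ) ℝ := ∑ i : σ, (X (inl i) - X (inr i)) ^ 2

variable (σ) in
/-- `Σ_i (v_i² + w_i²)`. [folklore] -/
@[folklore] private def sqPair : MvPolynomial (σ ⊕ σ) ℝ := ∑ i : σ, (X (inl i) ^ 2 + X (inr i) ^ 2)

/-- `q_{γ,r}(v,w) = p_{γ,r}(√v, √w)` with general weights: `p(v−w) − a(Σ(v_i−w_i)²)^d + b(Σ v_i²+w_i²)^d`.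
[folklore] -/
@[folklore] private def qForm (d : ℕ) (a b : ℝ) (p : MvPolynomial σ ℝ) : MvPolynomial (σ ⊕ σ) ℝ :=
  liftLin p - C a * diffLinSq σ ^ d + C b * sqPair σ ^ d

omit [Fintype σ] in
/-- `p(v−w)` after `X ↦ X²` is `p(v²−w²)`. [folklore] -/
@[folklore] private theorem expand_liftLin (p : MvPolynomial σ ℝ) : expand 2 (liftLin p) = liftSq p := by
  rw [liftLin, expand_bind₁]
  simp only [map_sub, expand_X]
  rfl

/-- [folklore] -/
@[folklore] private theorem expand_diffLinSq : expand 2 (diffLinSq σ) = diffSq σ := by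
  simp [diffLinSq, diffSq, map_sum, map_pow, map_sub, expand_X]

/-- [folklore] -/
@[folklore] private theorem expand_sqPair : expand 2 (sqPair σ) = quart σ := by
  simp [sqPair, quart, map_sum, map_pow, map_add, expand_X, ← pow_mul]

/-- `q_{γ,r}` after `X ↦ X²` is `p_{γ,r}`. [folklore] -/
@[folklore] private theorem expand_qForm (d : ℕ) (a b : ℝ) (p : MvPolynomial σ ℝ) :
    expand 2 (qForm d a b p) = pForm d a b p := by
  simp only [qForm, pForm, map_add, map_sub, map_mul, map_pow, expand_C, expand_liftLin,
    expand_diffLinSq, expand_sqPair]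

/-- `(Σ_j X_j)` after `X ↦ X²` is `Σ_j X_j²`. [folklore] -/
@[folklore] private theorem expand_sum_X :
    expand 2 (∑ j : σ ⊕ σ, X j : MvPolynomial (σ ⊕ σ) ℝ) = ∑ j, X j ^ 2 := by
  simp [map_sum, expand_X]

/-- The level-`r` polynomial is `p_{γ,r}`: `(p − a(Σ z_i²)^d)(v²−w²) = p(v²−w²) − a(Σ(v_i²−w_i²)²)^d`.
[cite: AhmadiHall2019, §4.1 Lemma 2 (eq:def.p.gamma) (p_{γ,r} is the lift of the level-r test form)] -/
theorem liftSq_level (f : MvPolynomial σ ℝ) (a : ℝ) (d : ℕ) :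
    liftSq (f - C a * (∑ i, X i ^ 2) ^ d) = liftSq f - C a * diffSq σ ^ d := by
  simp [liftSq, map_sub, map_mul, map_pow, map_sum, bind₁_X_right, diffSq]

omit [Fintype σ] in
/-- Evaluation of the lift: `p(v²−w²)(x) = p((x_{v,i}² − x_{w,i}²)_i)`. [folklore] -/
@[folklore] private theorem eval_liftSq (x : σ ⊕ σ → ℝ) (p : MvPolynomial σ ℝ) :
    eval x (liftSq p) = eval (fun i => x (inl i) ^ 2 - x (inr i) ^ 2) p := by
  show eval₂Hom (RingHom.id ℝ) x (bind₁ _ p) = _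
  rw [eval₂Hom_bind₁]
  show eval (fun i => eval x (X (inl i) ^ 2 - X (inr i) ^ 2 : MvPolynomial (σ ⊕ σ) ℝ)) p = _
  congr 2
  funext i
  simp

omit [Fintype σ] in
/-- [folklore] -/
@[folklore] private theorem eval_liftLin (x : σ ⊕ σ → ℝ) (p : MvPolynomial σ ℝ) :
    eval x (liftLin p) = eval (fun i => x (inl i) - x (inr i)) p := by
  show eval₂Hom (RingHom.id ℝ) x (bind₁ _ p) = _
  rw [eval₂Hom_bind₁]
  show eval (fun i => eval x (X (inl i) - X (inr i) : MvPolynomial (σ ⊕ σ) ℝ)) p = _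
  congr 2
  funext i
  simp

/-- Evaluation of `p_{γ,r}` (general weights). [folklore] -/
@[folklore] private theorem eval_pForm (x : σ ⊕ σ → ℝ) (d : ℕ) (a b : ℝ) (p : MvPolynomial σ ℝ) :
    eval x (pForm d a b p) = eval (fun i => x (inl i) ^ 2 - x (inr i) ^ 2) p
      - a * (∑ i, (x (inl i) ^ 2 - x (inr i) ^ 2) ^ 2) ^ d
      + b * (∑ i, (x (inl i) ^ 4 + x (inr i) ^ 4)) ^ d := by
  simp [pForm, eval_liftSq, diffSq, quart, map_sum]

/-- Evaluation of `q_{γ,r}` (general weights). [folklore] -/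
@[folklore] private theorem eval_qForm (y : σ ⊕ σ → ℝ) (d : ℕ) (a b : ℝ) (p : MvPolynomial σ ℝ) :
    eval y (qForm d a b p) = eval (fun i => y (inl i) - y (inr i)) p
      - a * (∑ i, (y (inl i) - y (inr i)) ^ 2) ^ d
      + b * (∑ i, (y (inl i) ^ 2 + y (inr i) ^ 2)) ^ d := by
  simp [qForm, eval_liftLin, diffLinSq, sqPair, map_sum]

omit [Fintype σ] in
/-- `p(v − w)` is a form of the same degree as `p`. [folklore] -/
@[folklore] private theorem liftLin_isHomogeneous (p : MvPolynomial σ ℝ) {n : ℕ} (hp : p.IsHomogeneous n) :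
    (liftLin p).IsHomogeneous n := by
  have := hp.aeval (fun i => (X (inl i) - X (inr i) : MvPolynomial (σ ⊕ σ) ℝ))
    (n := 1) (fun i => (isHomogeneous_X ℝ _).sub (isHomogeneous_X ℝ _))
  rw [one_mul] at this
  exact this

/-- `q_{γ,r}` is a form of degree `2d` when `p` is. [folklore] -/
@[folklore] private theorem qForm_isHomogeneous {d : ℕ} (a b : ℝ) (p : MvPolynomial σ ℝ)
    (hp : p.IsHomogeneous (2 * d)) : (qForm d a b p).IsHomogeneous (2 * d) := by
  have hX : ∀ i : σ, (X (inl i) - X (inr i) : MvPolynomial (σ ⊕ σ) ℝ).IsHomogeneous 1 := fun i =>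
    (isHomogeneous_X ℝ _).sub (isHomogeneous_X ℝ _)
  have h2 : (diffLinSq σ).IsHomogeneous 2 :=
    IsHomogeneous.sum _ _ _ fun i _ => by simpa using (hX i).pow 2
  have h3 : (sqPair σ).IsHomogeneous 2 :=
    IsHomogeneous.sum _ _ _ fun i _ => (isHomogeneous_X_pow _ 2).add (isHomogeneous_X_pow _ 2)
  exact ((liftLin_isHomogeneous p hp).sub ((h2.pow d).C_mul a)).add ((h3.pow d).C_mul b)

/-- The `ℓ¹`-norm of the coefficients (a bound for every coefficient; the paper's `‖·‖` is the
Powers–Reznick normalised max-norm). [folklore] -/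
@[folklore] private def cb {ι : Type*} (F : MvPolynomial ι ℝ) : ℝ := ∑ α ∈ F.support, |coeff α F|

/-- [folklore] -/
@[folklore] private theorem cb_nonneg {ι : Type*} (F : MvPolynomial ι ℝ) : 0 ≤ cb F :=
  Finset.sum_nonneg fun _ _ => abs_nonneg _

/-- [folklore] -/
@[folklore] private theorem abs_coeff_le_cb {ι : Type*} (F : MvPolynomial ι ℝ) (α : ι →₀ ℕ) :
    |coeff α F| ≤ cb F := by
  classical
  by_cases h : α ∈ F.support
  · exact Finset.single_le_sum (f := fun α => |coeff α F|) (fun _ _ => abs_nonneg _) h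
  · have h0 : coeff α F = 0 := by simpa [mem_support_iff] using h
    rw [h0, abs_zero]
    exact cb_nonneg F

/-- A form `f` of degree `n` is homogeneous under scaling of the argument: `f(c • x) = cⁿ f(x)`.
[folklore] -/
@[folklore] private theorem eval_smul_of_isHomogeneous {ι : Type*} [Fintype ι] (f : MvPolynomial ι ℝ)
    {n : ℕ} (hf : f.IsHomogeneous n) (c : ℝ) (x : ι → ℝ) : eval (c • x) f = c ^ n * eval x f := by
  rw [eval_eq', eval_eq', Finset.mul_sum]
  refine Finset.sum_congr rfl fun α hα => ?_
  have hdeg : ∑ i, α i = n := by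
    rw [← Finsupp.degree_eq_sum, Finsupp.degree_apply]
    exact (hf.degree_eq_sum_deg_support hα).symm
  simp_rw [Pi.smul_apply, smul_eq_mul, mul_pow, Finset.prod_mul_distrib,
    Finset.prod_pow_eq_pow_sum, hdeg]
  ring

/-- Nonnegative coefficients survive `X ↦ X²` (the coefficient of `x^m` in `G(x²)` is that of `x^{m/2}`
in `G`, or `0`). [folklore] -/
@[folklore] private theorem coeff_expand_two_nonneg {ι : Type*} (G : MvPolynomial ι ℝ)
    (hG : ∀ β, 0 ≤ coeff β G) (m : ι →₀ ℕ) : 0 ≤ coeff m (expand 2 G) := by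
  classical
  by_cases h : ∀ i, 2 ∣ m i
  · set m' : ι →₀ ℕ := m.mapRange (· / 2) (by simp) with hm'
    have h2 : 2 • m' = m := Finsupp.ext fun i => by
      simp only [hm', Finsupp.smul_apply, Finsupp.mapRange_apply, smul_eq_mul]
      exact Nat.mul_div_cancel' (h i)
    rw [← h2, coeff_expand_smul 2 two_ne_zero]
    exact hG m'
  · obtain ⟨i, hi⟩ := not_forall.1 h
    rw [coeff_expand_of_not_dvd G hi]

/-- Cauchy–Schwarz on the simplex: `Σ_j y_j = 1 ⇒ 1 ≤ |J| · Σ_j y_j²` (the paper's `‖x‖₂ ≤ n^{1/4}‖x‖₄`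
after `y = x²`). [folklore] -/
@[folklore] private theorem one_le_card_mul_sum_sq {ι : Type*} [Fintype ι] {y : ι → ℝ}
    (hy : ∑ j, y j = 1) : 1 ≤ (Fintype.card ι : ℝ) * ∑ j, y j ^ 2 := by
  have h := Finset.sum_mul_sq_le_sq_mul_sq Finset.univ y (fun _ => (1 : ℝ))
  simp only [mul_one, one_pow, Finset.sum_const, Finset.card_univ, nsmul_eq_mul, hy] at h
  linarith

/-! ### Soundness: nonnegativity of `p_{γ,r}` forces positive definiteness of `p` -/

/-- **The substitution step of the proof of Theorem 11** ((eq:ineq.tv.screen) ⇒ (eq:ineq.sphere)):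
if the lifted form `p(v²−w²) − a(Σ(v_i²−w_i²)²)^d + b(Σ v_i⁴+w_i⁴)^d` is nonnegative on `ℝ^{2n}`, then
`p(z) ≥ (a − b)(Σ z_i²)^d` for every `z` — "let `ẑ⁺ = max(ẑ,0)` and `ẑ⁻ = max(−ẑ,0)` … take
`v̂ = √ẑ⁺` and `ŵ = √ẑ⁻` … `ẑ = v̂² − ŵ²`" and `Σ v̂_i⁴ + ŵ_i⁴ = Σ ẑ_i²` (stated in the source on the
spheres `Σ v⁴+w⁴ = 1`, `S_z`, with `a − b = 1/r − 1/2r = 1/2r`; no homogeneity is needed for this step).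
[cite: AhmadiHall2019, §4.1 Theorem 11, Proof 8 ((eq:ineq.tv.screen)–(eq:ineq.sphere))] -/
theorem le_eval_of_pForm_nonneg (p : MvPolynomial σ ℝ) (d : ℕ) {a b : ℝ}
    (h : ∀ x : σ ⊕ σ → ℝ, 0 ≤ eval x (pForm d a b p)) (z : σ → ℝ) :
    (a - b) * (∑ i, z i ^ 2) ^ d ≤ eval z p := by
  set v : σ → ℝ := fun i => Real.sqrt (max (z i) 0) with hv
  set w : σ → ℝ := fun i => Real.sqrt (max (-z i) 0) with hw
  have hv2 : ∀ i, v i ^ 2 = max (z i) 0 := fun i => Real.sq_sqrt (le_max_right _ _)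
  have hw2 : ∀ i, w i ^ 2 = max (-z i) 0 := fun i => Real.sq_sqrt (le_max_right _ _)
  have h1 : ∀ i, v i ^ 2 - w i ^ 2 = z i := fun i => by
    rw [hv2, hw2]; exact max_zero_sub_max_neg_zero_eq_self (z i)
  have h2 : ∀ i, v i ^ 4 + w i ^ 4 = z i ^ 2 := fun i => by
    have e4 : ∀ t : ℝ, t ^ 4 = (t ^ 2) ^ 2 := fun t => by ring
    rw [e4, e4, hv2, hw2]
    rcases le_total 0 (z i) with hz | hz
    · rw [max_eq_left hz, max_eq_right (by linarith)]; ring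
    · rw [max_eq_right hz, max_eq_left (by linarith)]; ring
  have hx := h (Sum.elim v w)
  rw [eval_pForm] at hx
  simp only [Sum.elim_inl, Sum.elim_inr, h1, h2] at hx
  have e : (a - b) * (∑ i, z i ^ 2) ^ d = a * (∑ i, z i ^ 2) ^ d - b * (∑ i, z i ^ 2) ^ d := by ring
  rw [e]
  linarith

/-- **Membership in `Pol^r` makes `p_{γ,r}` an `r²`-dsos form** (the mechanism behind Corollary 3: the
product `p_{γ,r}(v,w)·(Σ v_i²+Σ w_i²)^{r²}` is an even form with nonnegative coefficients, i.e. a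
nonnegative combination of squared monomials, "`z(x)ᵀQz(x)` where `Q` is diagonal and has nonnegative
(diagonal) entries … such a `Q` is dd … we conclude that `p` is dsos").
[cite: AhmadiHall2019, §4.2 Corollary 3, Proof 10 (even forms with nonnegative coefficients are dsos)] -/
theorem isRDsos_of_memPol {r d : ℕ} {p : MvPolynomial σ ℝ}
    (h : MemPol r d (p - C (1 / (r : ℝ)) * (∑ i, X i ^ 2) ^ d)) :
    IsRDsos (r ^ 2) (pForm d (1 / (r : ℝ)) (1 / (2 * (r : ℝ))) p) := by
  set H : MvPolynomial (σ ⊕ σ) ℝ :=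
    qForm d (1 / (r : ℝ)) (1 / (2 * (r : ℝ))) p * (∑ j, X j) ^ (r ^ 2) with hH
  have hexp : expand 2 H = pForm d (1 / (r : ℝ)) (1 / (2 * (r : ℝ))) p * (∑ j, X j ^ 2) ^ (r ^ 2) := by
    rw [hH, map_mul, map_pow, expand_qForm, expand_sum_X]
  have hpoly : (liftSq (p - C (1 / (r : ℝ)) * (∑ i, X i ^ 2) ^ d) + C (1 / (2 * (r : ℝ))) * quart σ ^ d)
      * (∑ j, X j ^ 2) ^ (r ^ 2) = expand 2 H := by
    rw [hexp, liftSq_level]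
    rfl
  have hHc : ∀ β, 0 ≤ coeff β H := fun β => by
    rw [← coeff_expand_smul 2 two_ne_zero H β, ← hpoly]
    exact h _
  show IsDsos _
  rw [← hexp]
  exact isDsos_expand_two_of_coeff_nonneg H hHc

/-- **Theorem 11, the "`m_r ≤ p^*`" half, homogeneous form**: if `p − (1/r)(Σ z_i²)^d ∈ Pol^r_{n,2d}`
(`r ≥ 1`, `n ≥ 1`), then `p(z) ≥ (1/2r)(Σ_i z_i²)^d` for all `z` ("we conclude that `f_γ(z) ≥ 1/(2r)
∀ z ∈ S_z`").  [cite: AhmadiHall2019, §4.1 Theorem 11, Proof 8 (f_γ(z) ≥ 1/(2r) on S_z)] -/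
theorem le_eval_of_memPol [Nonempty σ] {r d : ℕ} (hr : 0 < r) {p : MvPolynomial σ ℝ}
    (h : MemPol r d (p - C (1 / (r : ℝ)) * (∑ i, X i ^ 2) ^ d)) (z : σ → ℝ) :
    1 / (2 * (r : ℝ)) * (∑ i, z i ^ 2) ^ d ≤ eval z p := by
  have hnn : ∀ x : σ ⊕ σ → ℝ, 0 ≤ eval x (pForm d (1 / (r : ℝ)) (1 / (2 * (r : ℝ))) p) :=
    (isRDsos_of_memPol h).eval_nonneg
  have key := le_eval_of_pForm_nonneg p d hnn z
  have hr' : (r : ℝ) ≠ 0 := by exact_mod_cast hr.ne'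
  have e : 1 / (r : ℝ) - 1 / (2 * r) = 1 / (2 * r) := by
    field_simp
    ring
  rw [e] at key
  exact key

/-- **Theorem 11, the "`m_r ≤ p^*`" half**: "if `f_γ(z) − (1/r)(Σ_i z_i²)^D ∈ Pol^r_{N,2D}` for some `r`,
then `f_γ` must be positive definite" — for any form (indeed any polynomial) `p` in `n ≥ 1` variables.
[cite: AhmadiHall2019, §4.1 Theorem 11, Proof 8 (membership in Pol^r ⇒ f_γ positive definite)] -/
theorem posDef_of_memPol [Nonempty σ] {r d : ℕ} (hr : 0 < r) {p : MvPolynomial σ ℝ}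
    (h : MemPol r d (p - C (1 / (r : ℝ)) * (∑ i, X i ^ 2) ^ d)) (z : σ → ℝ) (hz : z ≠ 0) :
    0 < eval z p := by
  obtain ⟨i, hi⟩ : ∃ i, z i ≠ 0 := by
    by_contra hne
    exact hz (funext fun i => by simpa using not_exists.1 hne i)
  have hs : 0 < ∑ j, z j ^ 2 := lt_of_lt_of_le (by positivity : 0 < z i ^ 2)
    (Finset.single_le_sum (fun j _ => sq_nonneg (z j)) (Finset.mem_univ i))
  have hr0 : (0 : ℝ) < r := by exact_mod_cast hr
  exact lt_of_lt_of_le (by positivity) (le_eval_of_memPol hr h z)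

/-! ### Completeness: positive definite forms pass the level-`r` test for all large `r` -/

/-- **The constant `r₀` of Lemma 2**: a positive definite form of degree `2d` in `n ≥ 1` variables
satisfies `p(z) ≥ μ (Σ_i z_i²)^d` for some `μ > 0` (the minimum of `p` on the unit sphere), so that
"there exists a positive integer `r₀` such that `f_γ(z) − (1/r)(Σ_{i=1}^N z_i²)^D` is positive definite
for all `r ≥ r₀`" (any `r₀ > 1/μ`).
[cite: AhmadiHall2019, §4.1 Lemma 2, Proof 7 (existence of r₀)] -/
theorem exists_pos_mul_le_eval [Nonempty σ] (p : MvPolynomial σ ℝ) {d : ℕ}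
    (hhom : p.IsHomogeneous (2 * d)) (hpd : ∀ z : σ → ℝ, z ≠ 0 → 0 < eval z p) :
    ∃ μ : ℝ, 0 < μ ∧ ∀ z : σ → ℝ, μ * (∑ i, z i ^ 2) ^ d ≤ eval z p := by
  classical
  set S : Set (σ → ℝ) := {z | ∑ i, z i ^ 2 = 1} with hS
  have hS_closed : IsClosed S :=
    isClosed_eq (continuous_finsetSum _ fun i _ => (continuous_apply i).pow 2) continuous_const
  have hS_bdd : Bornology.IsBounded S := by
    refine (Metric.isBounded_closedBall (x := (0 : σ → ℝ)) (r := 1)).subset fun z hz => ?_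
    rw [mem_closedBall_zero_iff, pi_norm_le_iff_of_nonneg zero_le_one]
    intro i
    rw [Real.norm_eq_abs, ← sq_le_one_iff_abs_le_one]
    calc z i ^ 2 ≤ ∑ j, z j ^ 2 :=
          Finset.single_le_sum (fun j _ => sq_nonneg (z j)) (Finset.mem_univ i)
      _ = 1 := hz
  have hS_cpt : IsCompact S := Metric.isCompact_of_isClosed_isBounded hS_closed hS_bdd
  obtain ⟨i₀⟩ := ‹Nonempty σ›
  have hS_ne : S.Nonempty := by
    refine ⟨fun i => if i = i₀ then 1 else 0, ?_⟩
    show ∑ i, (if i = i₀ then (1 : ℝ) else 0) ^ 2 = 1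
    have : ∀ i, (if i = i₀ then (1 : ℝ) else 0) ^ 2 = if i = i₀ then 1 else 0 := fun i => by
      split_ifs <;> norm_num
    simp_rw [this]
    simp
  obtain ⟨zm, hzm, hmin⟩ := hS_cpt.exists_isMinOn hS_ne (continuous_eval p).continuousOn
  have hzm1 : ∑ i, zm i ^ 2 = 1 := hzm
  have hzm0 : zm ≠ 0 := by
    rintro h0
    rw [h0] at hzm1
    simp at hzm1
  refine ⟨eval zm p, hpd zm hzm0, fun z => ?_⟩
  set s : ℝ := ∑ i, z i ^ 2 with hs
  have hs0 : 0 ≤ s := Finset.sum_nonneg fun i _ => sq_nonneg (z i)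
  rcases hs0.eq_or_lt with hs_zero | hs_pos
  · -- `Σ z_i² = 0`: `z = 0`, and `p(0) = 0^{2d} · p(z_m)`
    have hz : z = 0 := by
      funext i
      have := (Finset.sum_eq_zero_iff_of_nonneg fun j _ => sq_nonneg (z j)).1 hs_zero.symm i
        (Finset.mem_univ i)
      exact (pow_eq_zero_iff two_ne_zero).1 this
    have h0 : eval z p = (0 : ℝ) ^ (2 * d) * eval zm p := by
      rw [← eval_smul_of_isHomogeneous p hhom 0 zm, zero_smul, hz]
    rw [h0, ← hs_zero]
    rcases Nat.eq_zero_or_pos d with hd | hd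
    · subst hd; simp
    · rw [zero_pow hd.ne', zero_pow (by omega), mul_zero, zero_mul]
  · set t : ℝ := Real.sqrt s with ht
    have ht_pos : 0 < t := Real.sqrt_pos.2 hs_pos
    have ht2 : t ^ 2 = s := Real.sq_sqrt hs0
    set u : σ → ℝ := t⁻¹ • z with hu
    have huS : u ∈ S := by
      show ∑ i, u i ^ 2 = 1
      simp only [hu, Pi.smul_apply, smul_eq_mul, mul_pow, ← Finset.mul_sum]
      rw [← hs, inv_pow, ht2, inv_mul_cancel₀ hs_pos.ne']
    have hzu : z = t • u := by rw [hu, smul_inv_smul₀ ht_pos.ne']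
    have hmin' : eval zm p ≤ eval u p := (isMinOn_iff.1 hmin) u huS
    calc eval zm p * s ^ d = eval zm p * t ^ (2 * d) := by rw [pow_mul, ht2]
      _ ≤ eval u p * t ^ (2 * d) := mul_le_mul_of_nonneg_right hmin' (pow_nonneg ht_pos.le _)
      _ = eval z p := by rw [hzu, eval_smul_of_isHomogeneous p hhom t u, mul_comm]

/-- **Lemma 1 (Powers–Reznick for even forms, through `q(x) = p(√x)`)**, in the in-tree normalisation of
the Powers–Reznick bound: let `p = q(x²)` be an even form, `q` a form of degree `d` with
`|q_α| ≤ L·|α|!/α!`, and suppose `p ≥ β` on the unit sphere `S_x = {Σ x_i² = 1}` ("since `p ≥ β` on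
`S_x`, then `q ≥ β` on `Δ_n`"); if `L·C(d,2) < β(N + d)` then `p·(Σ_i x_i²)^N` has nonnegative
coefficients ("`q(x)(Σ_i x_i)^N` has nonnegative coefficients.  Hence `q(y²)(Σ_i y_i²)^N = p(y)(Σ y_i²)^N`
also has nonnegative coefficients").  The source states the threshold as `N > d(2d−1)‖q‖/β − 2d`
for a form of degree `2d` in the Powers–Reznick max-norm.
[cite: AhmadiHall2019, §4.1 Lemma 1 (th:Reznick.even), Proof 6] [cite: PowersReznick2001, Thm 1] -/
theorem coeff_mul_sumSq_pow_nonneg_of_even (q : MvPolynomial σ ℝ) {d : ℕ} (hq : q.IsHomogeneous d)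
    {L β : ℝ} (hL : ∀ α : σ →₀ ℕ, |coeff α q| ≤ L * (α.multinomial : ℝ))
    (hβ : ∀ y : σ → ℝ, ∑ i, y i ^ 2 = 1 → β ≤ eval y (expand 2 q))
    {N : ℕ} (hN : L * (d.choose 2 : ℝ) < β * (N + d : ℝ)) (m : σ →₀ ℕ) :
    0 ≤ coeff m (expand 2 q * (∑ i, X i ^ 2) ^ N) := by
  classical
  have hβΔ : ∀ x ∈ stdSimplex ℝ σ, β ≤ eval x q := by
    intro x hx
    have h1 : ∑ i, Real.sqrt (x i) ^ 2 = 1 := by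
      simp_rw [Real.sq_sqrt (hx.1 _)]
      exact hx.2
    have h2 := hβ _ h1
    rw [eval_expand] at h2
    have hx2 : ((fun i => Real.sqrt (x i)) ^ 2) = x := funext fun i => by
      simp [Real.sq_sqrt (hx.1 i)]
    rw [hx2] at h2
    exact h2
  have hPR := polya_powersReznick q hq hL hβΔ hN
  have hGhom : ((∑ i, X i) ^ N * q : MvPolynomial σ ℝ).IsHomogeneous (1 * N + d) :=
    ((IsHomogeneous.sum univ (fun i => (X i : MvPolynomial σ ℝ)) 1
      fun i _ => isHomogeneous_X ℝ i).pow N).mul hq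
  have hG : ∀ β', 0 ≤ coeff β' ((∑ i, X i) ^ N * q : MvPolynomial σ ℝ) := by
    intro β'
    by_cases hβ' : Finsupp.degree β' = N + d
    · exact (hPR β' hβ').le
    · rw [hGhom.coeff_eq_zero (by omega)]
  have hexp : expand 2 q * (∑ i, X i ^ 2) ^ N = expand 2 ((∑ i, X i) ^ N * q : MvPolynomial σ ℝ) := by
    rw [map_mul, map_pow, map_sum]
    simp only [expand_X]
    ring
  rw [hexp]
  exact coeff_expand_two_nonneg _ hG m

/-- **Theorem 11, the "`lim m_r = p^*`" half, with Lemma 2**: a positive definite form `p` of degree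
`2d` in `n ≥ 1` variables passes the level-`r` test `p − (1/r)(Σ_i z_i²)^d ∈ Pol^r_{n,2d}` for ALL
sufficiently large `r` — i.e. `(p(v²−w²) − (1/r)(Σ(v_i²−w_i²)²)^d + (1/2r)(Σ v_i⁴+w_i⁴)^d)·(Σ v_i²+Σ w_i²)^{r²}`
has nonnegative coefficients.  Proof as printed: with `μ` from `exists_pos_mul_le_eval` and `r ≥ 1/μ` the
form `q_r(v,w) = p(v−w) − (1/r)(Σ(v_i−w_i)²)^d + (1/2r)(Σ v_i²+w_i²)^d` is `≥ (1/2r)(1/2n)^d` on the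
standard simplex of `ℝ^{2n}` (the paper's (eq:min.p.gamma), `‖x‖₂ ≤ n^{1/4}‖x‖₄`), its coefficients are
bounded uniformly in `r ≥ 1` ("`‖q_{γ,r}‖ ≤ … =: c_γ`"), so the Powers–Reznick exponent
`C(2d,2)·c/λ_r − 2d = O(r)` is eventually `≤ r²` ("taking `r̂ = max(r₀, ⌈D(2D−1)2^{D+1}N^D c_γ⌉)`, we have
`r² ≥ N̄(r) ∀ r ≥ r̂`"); Powers–Reznick (`polya_powersReznick`) then makes all coefficients of
`q_r·(Σ_j X_j)^{r²}` nonnegative, and `X ↦ X²` gives the claim.  The threshold used here is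
`r₁ = max(⌈1/μ⌉, ⌈2(2n)^d C(2d,2) c⌉ + 1)`, `c` = sum of the `ℓ¹` coefficient norms of `p(v−w)`,
`(Σ(v_i−w_i)²)^d`, `(Σ v_i²+w_i²)^d`.
[cite: AhmadiHall2019, §4.1 Theorem 11 (lim m_r = p^*: pd ⇒ level-r test passes) with Lemma 2 (lem:outstrip)]
[cite: PowersReznick2001, Thm 1] -/
theorem exists_memPol_of_posDef [Nonempty σ] (p : MvPolynomial σ ℝ) {d : ℕ}
    (hhom : p.IsHomogeneous (2 * d)) (hpd : ∀ z : σ → ℝ, z ≠ 0 → 0 < eval z p) :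
    ∃ r₁ : ℕ, 0 < r₁ ∧ ∀ r : ℕ, r₁ ≤ r → MemPol r d (p - C (1 / (r : ℝ)) * (∑ i, X i ^ 2) ^ d) := by
  classical
  obtain ⟨μ, hμ, hμp⟩ := exists_pos_mul_le_eval p hhom hpd
  -- the data of Lemma 2: `n`, the uniform coefficient bound `L` (the paper's `c_γ`), the threshold `T`
  set n : ℕ := Fintype.card σ with hn_def
  have hn_pos : (0 : ℝ) < n := by exact_mod_cast (Fintype.card_pos : 0 < Fintype.card σ)
  set L : ℝ := cb (liftLin p) + cb (diffLinSq σ ^ d) + cb (sqPair σ ^ d) with hL_def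
  have hL0 : 0 ≤ L := add_nonneg (add_nonneg (cb_nonneg _) (cb_nonneg _)) (cb_nonneg _)
  set T : ℝ := 2 * (2 * (n : ℝ)) ^ d * ((2 * d).choose 2 : ℝ) * L with hT_def
  refine ⟨max ⌈1 / μ⌉₊ (⌈T⌉₊ + 1), lt_max_of_lt_right (Nat.succ_pos _), fun r hr => ?_⟩
  have hr₁ := (max_le_iff.1 hr).1
  have hr₂ := (max_le_iff.1 hr).2
  have hr1 : (1 : ℝ) ≤ r := by exact_mod_cast (show 1 ≤ r by omega)
  have hrpos : (0 : ℝ) < r := by linarith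
  have hrμ : 1 / (r : ℝ) ≤ μ := by
    have h1 : 1 / μ ≤ (r : ℝ) := (Nat.le_ceil _).trans (by exact_mod_cast hr₁)
    rw [div_le_iff₀ hμ] at h1
    rw [div_le_iff₀ hrpos]
    linarith
  have hrT : T < r := by
    have h1 : ((⌈T⌉₊ : ℕ) : ℝ) + 1 ≤ r := by exact_mod_cast hr₂
    linarith [Nat.le_ceil T]
  have hinv1 : 1 / (r : ℝ) ≤ 1 := (div_le_one hrpos).2 hr1
  have hinv2 : 1 / (2 * (r : ℝ)) ≤ 1 := (div_le_one (by linarith)).2 (by linarith)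
  -- the form `q_r` to which Powers–Reznick is applied
  set G : MvPolynomial (σ ⊕ σ) ℝ := qForm d (1 / (r : ℝ)) (1 / (2 * (r : ℝ))) p with hG_def
  have hGhom : G.IsHomogeneous (2 * d) := qForm_isHomogeneous _ _ p hhom
  -- uniform coefficient bound ("‖q_{γ,r}‖ ≤ c_γ")
  have hGL : ∀ α : σ ⊕ σ →₀ ℕ, |coeff α G| ≤ L * (α.multinomial : ℝ) := by
    intro α
    have hc : coeff α G = coeff α (liftLin p) - 1 / (r : ℝ) * coeff α (diffLinSq σ ^ d)
        + 1 / (2 * (r : ℝ)) * coeff α (sqPair σ ^ d) := by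
      simp only [hG_def, qForm, coeff_add, coeff_sub, coeff_C_mul]
    have hm1 : (1 : ℝ) ≤ (α.multinomial : ℝ) := by
      rw [Finsupp.multinomial_eq]
      exact_mod_cast Nat.multinomial_pos _ _
    have t1 := abs_add_le (coeff α (liftLin p) - 1 / (r : ℝ) * coeff α (diffLinSq σ ^ d))
      (1 / (2 * (r : ℝ)) * coeff α (sqPair σ ^ d))
    have t2 := abs_sub (coeff α (liftLin p)) (1 / (r : ℝ) * coeff α (diffLinSq σ ^ d))
    have t3 : |1 / (r : ℝ) * coeff α (diffLinSq σ ^ d)| ≤ |coeff α (diffLinSq σ ^ d)| := by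
      rw [abs_mul, abs_of_nonneg (by positivity)]
      exact mul_le_of_le_one_left (abs_nonneg _) hinv1
    have t4 : |1 / (2 * (r : ℝ)) * coeff α (sqPair σ ^ d)| ≤ |coeff α (sqPair σ ^ d)| := by
      rw [abs_mul, abs_of_nonneg (by positivity)]
      exact mul_le_of_le_one_left (abs_nonneg _) hinv2
    have c1 := abs_coeff_le_cb (liftLin p) α
    have c2 := abs_coeff_le_cb (diffLinSq σ ^ d) α
    have c3 := abs_coeff_le_cb (sqPair σ ^ d) α
    calc |coeff α G| ≤ L := by rw [hc]; linarith
      _ ≤ L * (α.multinomial : ℝ) := le_mul_of_one_le_right hL0 hm1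
  -- lower bound on the simplex ((eq:min.p.gamma)): `q_r ≥ λ_r := (1/2r)(1/2n)^d`
  set lam : ℝ := 1 / (2 * (r : ℝ)) * (1 / (2 * (n : ℝ))) ^ d with hlam_def
  have hlam_pos : 0 < lam := by positivity
  have hlam : ∀ y ∈ stdSimplex ℝ (σ ⊕ σ), lam ≤ eval y G := by
    intro y hy
    rw [hG_def, eval_qForm]
    have hμz := hμp (fun i => y (inl i) - y (inr i))
    have hA : 1 / (r : ℝ) * (∑ i, (y (inl i) - y (inr i)) ^ 2) ^ d
        ≤ eval (fun i => y (inl i) - y (inr i)) p :=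
      (mul_le_mul_of_nonneg_right hrμ (by positivity)).trans hμz
    have hsum : ∑ i, (y (inl i) ^ 2 + y (inr i) ^ 2) = ∑ j, y j ^ 2 := by
      rw [Fintype.sum_sum_type, Finset.sum_add_distrib]
    have hCS := one_le_card_mul_sum_sq hy.2
    rw [Fintype.card_sum] at hCS
    push_cast at hCS
    have hB : (1 / (2 * (n : ℝ))) ^ d ≤ (∑ i, (y (inl i) ^ 2 + y (inr i) ^ 2)) ^ d := by
      apply pow_le_pow_left₀ (by positivity)
      rw [hsum, div_le_iff₀ (by positivity)]
      linarith
    have hB' := mul_le_mul_of_nonneg_left hB (by positivity : (0 : ℝ) ≤ 1 / (2 * (r : ℝ)))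
    rw [hlam_def]
    linarith
  -- the Powers–Reznick exponent is below `r²` ("r² ≥ N̄(r) for r ≥ r̂")
  have hK : (0 : ℝ) < 2 * (2 * (n : ℝ)) ^ d := by positivity
  have e1 : L * ((2 * d).choose 2 : ℝ) * (2 * (2 * (n : ℝ)) ^ d) = T := by
    rw [hT_def]; ring
  have e2 : lam * (r : ℝ) ^ 2 * (2 * (2 * (n : ℝ)) ^ d) = r := by
    have h2n : (2 * (n : ℝ)) ≠ 0 := ne_of_gt (by linarith)
    have h2r : (2 * (r : ℝ)) ≠ 0 := ne_of_gt (by linarith)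
    have hone : (1 / (2 * (n : ℝ))) ^ d * (2 * (n : ℝ)) ^ d = 1 := by
      rw [← mul_pow, one_div, inv_mul_cancel₀ h2n, one_pow]
    calc lam * (r : ℝ) ^ 2 * (2 * (2 * (n : ℝ)) ^ d)
        = 1 / (2 * (r : ℝ)) * (r : ℝ) ^ 2 * 2 * ((1 / (2 * (n : ℝ))) ^ d * (2 * (n : ℝ)) ^ d) := by
          rw [hlam_def]; ring
      _ = (2 * (r : ℝ))⁻¹ * (2 * (r : ℝ)) * r := by rw [hone, mul_one]; ring
      _ = r := by rw [inv_mul_cancel₀ h2r, one_mul]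
  have key : L * ((2 * d).choose 2 : ℝ) < lam * (r : ℝ) ^ 2 := by
    have f1 : L * ((2 * d).choose 2 : ℝ) = T / (2 * (2 * (n : ℝ)) ^ d) := by
      rw [eq_div_iff hK.ne']; exact e1
    have f2 : lam * (r : ℝ) ^ 2 = r / (2 * (2 * (n : ℝ)) ^ d) := by
      rw [eq_div_iff hK.ne']; exact e2
    rw [f1, f2]
    exact div_lt_div_of_pos_right hrT hK
  have hPR := polya_powersReznick G hGhom hGL hlam (N := r ^ 2) (by
    push_cast
    nlinarith [key, hlam_pos.le])
  -- all coefficients of `(Σ_j X_j)^{r²} · q_r` are nonnegative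
  have hHhom : ((∑ j, X j) ^ (r ^ 2) * G : MvPolynomial (σ ⊕ σ) ℝ).IsHomogeneous (1 * r ^ 2 + 2 * d) :=
    ((IsHomogeneous.sum univ (fun j => (X j : MvPolynomial (σ ⊕ σ) ℝ)) 1
      fun j _ => isHomogeneous_X ℝ j).pow (r ^ 2)).mul hGhom
  have hH : ∀ β, 0 ≤ coeff β ((∑ j, X j) ^ (r ^ 2) * G : MvPolynomial (σ ⊕ σ) ℝ) := by
    intro β
    by_cases hβ : Finsupp.degree β = r ^ 2 + 2 * d
    · exact (hPR β hβ).le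
    · rw [hHhom.coeff_eq_zero (by omega)]
  -- substitute `(v, w) ↦ (v², w²)`
  have hpoly : (liftSq (p - C (1 / (r : ℝ)) * (∑ i, X i ^ 2) ^ d) + C (1 / (2 * (r : ℝ))) * quart σ ^ d)
      * (∑ j, X j ^ 2) ^ (r ^ 2) = expand 2 ((∑ j, X j) ^ (r ^ 2) * G : MvPolynomial (σ ⊕ σ) ℝ) := by
    rw [liftSq_level, map_mul, map_pow, expand_sum_X, hG_def, expand_qForm, mul_comm]
    rfl
  intro m
  rw [hpoly]
  exact coeff_expand_two_nonneg _ hH m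

/-- **Theorem 11 / the global case of Corollary 2 ("An optimization-free Positivstellensatz")**: a form
`p` of degree `2d` in `n ≥ 1` variables is positive definite iff for some positive integer `r` the
polynomial `(p(v²−w²) − (1/r)(Σ_i(v_i²−w_i²)²)^d + (1/2r)(Σ_i v_i⁴+w_i⁴)^d)·(Σ_i v_i² + Σ_i w_i²)^{r²}` has
nonnegative coefficients — "one can always certify [positivity] by recursively multiplying polynomials
together and simply checking nonnegativity of the coefficients of the resulting polynomial".
[cite: AhmadiHall2019, §4.1 Theorem 11 and Corollary 2 (global positivity case)] -/
theorem posDef_iff_exists_memPol [Nonempty σ] (p : MvPolynomial σ ℝ) {d : ℕ}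
    (hhom : p.IsHomogeneous (2 * d)) :
    (∀ z : σ → ℝ, z ≠ 0 → 0 < eval z p) ↔
      ∃ r : ℕ, 0 < r ∧ MemPol r d (p - C (1 / (r : ℝ)) * (∑ i, X i ^ 2) ^ d) := by
  constructor
  · intro hpd
    obtain ⟨r₁, hr₁, h⟩ := exists_memPol_of_posDef p hhom hpd
    exact ⟨r₁, hr₁, h r₁ le_rfl⟩
  · rintro ⟨r, hr, h⟩
    exact posDef_of_memPol hr h

/-- **Theorem 8 of Ahmadi–Majumdar (r-dsos form).** "An `n`-variate form `p` of degree `2d` is positive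
definite if and only if there exists a positive integer `r` that makes the following form r-dsos:
`p(v²−w²) − (1/√r)(Σ_{i=1}^n (v_i²−w_i²)²)^d + (1/(2√r))(Σ_{i=1}^n (v_i⁴+w_i⁴))^d`."  ("⇐": an r-dsos
form is nonnegative (`IsRDsos.eval_nonneg`), then the substitution `v = √z⁺`, `w = √z⁻` gives
`p(z) ≥ (1/(2√r))(Σ z_i²)^d`; "⇒": Theorem 11 with `r²` in place of `r`, the product being an even form
with nonnegative coefficients and hence dsos.)
[cite: AhmadiMajumdar2019, §3.2 Theorem 8 (pd ⇔ r-dsos after lifting; see Section 4 of [pop_hierarchy])]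
[cite: AhmadiHall2019, §4.2 Corollary 3] -/
theorem posDef_iff_exists_isRDsos [Nonempty σ] (p : MvPolynomial σ ℝ) {d : ℕ}
    (hhom : p.IsHomogeneous (2 * d)) :
    (∀ z : σ → ℝ, z ≠ 0 → 0 < eval z p) ↔
      ∃ r : ℕ, 0 < r ∧ IsRDsos r (pForm d (1 / Real.sqrt r) (1 / (2 * Real.sqrt r)) p) := by
  constructor
  · intro hpd
    obtain ⟨r₁, hr₁, h⟩ := exists_memPol_of_posDef p hhom hpd
    refine ⟨r₁ ^ 2, by positivity, ?_⟩
    have hsq : Real.sqrt ((r₁ ^ 2 : ℕ) : ℝ) = r₁ := by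
      rw [Nat.cast_pow, Real.sqrt_sq (Nat.cast_nonneg _)]
    rw [hsq]
    exact isRDsos_of_memPol (h r₁ le_rfl)
  · rintro ⟨r, hr, h⟩ z hz
    have hnn : ∀ x : σ ⊕ σ → ℝ, 0 ≤ eval x (pForm d (1 / Real.sqrt r) (1 / (2 * Real.sqrt r)) p) :=
      h.eval_nonneg
    have key := le_eval_of_pForm_nonneg p d hnn z
    have hsr : 0 < Real.sqrt r := Real.sqrt_pos.2 (by exact_mod_cast hr)
    have e : 1 / Real.sqrt r - 1 / (2 * Real.sqrt r) = 1 / (2 * Real.sqrt r) := by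
      field_simp
      ring
    rw [e] at key
    obtain ⟨i, hi⟩ : ∃ i, z i ≠ 0 := by
      by_contra hne
      exact hz (funext fun i => by simpa using not_exists.1 hne i)
    have hs : 0 < ∑ j, z j ^ 2 := lt_of_lt_of_le (by positivity : 0 < z i ^ 2)
      (Finset.single_le_sum (fun j _ => sq_nonneg (z j)) (Finset.mem_univ i))
    exact lt_of_lt_of_le (by positivity) key

end Literature.Algebra.Polynomial.OptimizationFreePositivstellensatz

end
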